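import Summits.ValiantsHypothesis.ValiantsHypothesis.Theorems.LacunarySymmetroidMatrixDescartesCensusPivotDefs
import Summits.ValiantsHypothesis.ValiantsHypothesis.Theorems.SymmetroidPencilBasics

/-!
# `MatrixDescartes` census — pivot-pencil certificate kit (alternation certificate ⇒ `Z₊ ≥ N` ⇒ refuted pivot row)

HONEST FRAMING.  Bookkeeping for the object-search cell `pub-symmetroid`'s Conjecture-B column in PIVOT currency
(`…CensusPivotDefs.lean`: `pivotPosRoots`, `PivotRootLawAt`; seat conjb-1, typed by the typer g8).  The two lemmas below
package what every pivot certificate file repeats — evaluate `det (X^e • J + ∑ X^{d k} • P k)` at a real point through a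
closed form `f`, count sign alternations of `f` along `N + 1` increasing positive rational points (tree lemma
`SymmetroidDescartes.le_card_posRoots_of_alternating`, intermediate value theorem), and specialise a would-be row
`PivotRootLawAt m K q B` at the explicit pencil — so that a certificate file states its pencil ONCE, inside the
closed-form identity, from which `e`, `d`, `J`, `P` are read off by unification (the pattern of `…CensusKit.lean`).
Landed as a HELPER of the crux item stmt-ValiantsHypothesis-18050 with no closure claim; nothing here bears on
`Theses.LacunarySymmetroid.MatrixDescartes`, on `KPlusLogSqLaw`, or on `VP ≠ VNP`.

[folklore] Elementary (intermediate value theorem; `det` commutes with evaluation).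
-/

-- `Summit.ValiantsHypothesis.ValiantsHypothesis.…` repeats a component by the D-0017 layout
-- (single-conjunct summit), which the `dupNamespace` linter flags; the name is mandated.
set_option linter.dupNamespace false

namespace Summit.ValiantsHypothesis.ValiantsHypothesis.Theorems.LacunarySymmetroidMatrixDescartes.Pivot

open Summit.ValiantsHypothesis.ValiantsHypothesis.Theorems.SymmetroidDescartes (le_card_posRoots_of_alternating)
open scoped BigOperators Matrix
open Polynomial

/-- Evaluation commutes with the determinant of a pivot pencil:
`(det (X^e • J + ∑ X^{d k} • P k)).eval t = det (t^e • J + ∑ t^{d k} • P k)`. [folklore] -/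
theorem eval_det_pivot {m K : ℕ} (e : ℕ) (d : Fin K → ℕ) (J : Matrix (Fin m) (Fin m) ℝ)
    (P : Fin K → Matrix (Fin m) (Fin m) ℝ) (t : ℝ) :
    (Matrix.det (((X : ℝ[X]) ^ e) • J.map Polynomial.C
        + ∑ k, ((X : ℝ[X]) ^ d k) • (P k).map Polynomial.C)).eval t
      = (t ^ e • J + ∑ k, t ^ d k • P k).det := by
  have h := RingHom.map_det (Polynomial.evalRingHom t)
    (((X : ℝ[X]) ^ e) • J.map Polynomial.C + ∑ k, ((X : ℝ[X]) ^ d k) • (P k).map Polynomial.C)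
  rw [Polynomial.coe_evalRingHom] at h
  rw [h]
  congr 1
  ext i j
  rw [RingHom.mapMatrix_apply, Matrix.map_apply, Matrix.add_apply, Matrix.add_apply, Matrix.smul_apply,
    Matrix.smul_apply, Matrix.sum_apply, Matrix.sum_apply]
  simp only [Matrix.smul_apply, Matrix.map_apply, smul_eq_mul, Polynomial.coe_evalRingHom, Polynomial.eval_add,
    Polynomial.eval_mul, Polynomial.eval_pow, Polynomial.eval_X, Polynomial.eval_C, Polynomial.eval_finsetSum]

/-- **Certificate ⇒ count.**  If the explicit pivot pencil has `det (t^e • J + ∑ t^{d k} • P k) = f t` for all real `t`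
and `f` alternates strictly in sign along `N + 1` strictly increasing positive points, then `N ≤ Z₊`
(`pivotPosRoots e d J P`).  In a certificate file `e`, `d`, `J`, `P`, `f` are supplied by unification from `hf`. [folklore] -/
theorem le_pivotPosRoots_of_certificate {m K N : ℕ} {e : ℕ} {d : Fin K → ℕ} {J : Matrix (Fin m) (Fin m) ℝ}
    {P : Fin K → Matrix (Fin m) (Fin m) ℝ} {f : ℝ → ℝ}
    (hf : ∀ t : ℝ, (t ^ e • J + ∑ k, t ^ d k • P k).det = f t)
    (τ : Fin (N + 1) → ℝ) (hτ : StrictMono τ) (hpos : ∀ j, 0 < τ j)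
    (halt : ∀ j : Fin N, f (τ j.castSucc) * f (τ j.succ) < 0) :
    N ≤ pivotPosRoots e d J P := by
  unfold pivotPosRoots
  exact le_card_posRoots_of_alternating _ N τ hτ hpos (fun j => by
    rw [eval_det_pivot, eval_det_pivot, hf, hf]; exact halt j)

/-- **Certificate ⇒ refuted row.**  With the data of `le_pivotPosRoots_of_certificate`, if moreover `J` is symmetric,
every `P k ⪰ 0` and `J + W Wᵀ ⪰ 0` for an explicit `m × q` matrix `W`, then no row «`Z₊ ≤ B`» with `B < N` holds at
format `(m, K)` and index `q`: `¬ PivotRootLawAt m K q B`. [folklore] -/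
theorem not_pivotRootLawAt_of_certificate {m K q B N : ℕ} {e : ℕ} {d : Fin K → ℕ} {J : Matrix (Fin m) (Fin m) ℝ}
    {P : Fin K → Matrix (Fin m) (Fin m) ℝ} {f : ℝ → ℝ}
    (hf : ∀ t : ℝ, (t ^ e • J + ∑ k, t ^ d k • P k).det = f t)
    (hJ : J.IsSymm) (hP : ∀ k, (P k).PosSemidef) (W : Matrix (Fin m) (Fin q) ℝ) (hW : (J + W * Wᵀ).PosSemidef)
    (τ : Fin (N + 1) → ℝ) (hτ : StrictMono τ) (hpos : ∀ j, 0 < τ j)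
    (halt : ∀ j : Fin N, f (τ j.castSucc) * f (τ j.succ) < 0) (hB : B < N) :
    ¬ PivotRootLawAt m K q B := by
  intro h
  have hle := h e d J P hJ hP ⟨W, hW⟩
  have hN := le_pivotPosRoots_of_certificate hf τ hτ hpos halt
  omega

end Summit.ValiantsHypothesis.ValiantsHypothesis.Theorems.LacunarySymmetroidMatrixDescartes.Pivot
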